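import Literature.Algebra.Lie.LefschetzTripleRepresentation
import Literature.Algebra.Lie.LefschetzTripleIdeals
import HarnessLib

/-!
# Lefschetz triples pass to surjective images and to ideal factors `𝔤 = 𝔤' × 𝔤''` (Looijenga–Lunts 1997, (1.2) Lemma)

Topic `Literature/Algebra/Lie` (namespace `Literature.Algebra.Lie`).  Lane `lit-hodgefound` (Track 2 foundations
library), skeleton seat `lit-hodgefound-skel-1` (generation 44), row **A1-136** of
`run/shared/lean/pub/lit-hodgefound/SKELETON.md`; sequel of A1-112 `LefschetzTripleIdeals.lean` (the graded clause of
the (1.2) Lemma), A1-87 `LefschetzTripleTransport.lean` (`IsLefschetzTriple.map` along ISOMORPHISMS) and A1-106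
`LefschetzTripleRepresentation.lean` (every representation of a Lefschetz triple is a Lefschetz module, `𝔤(𝔞, M)` the
image of `𝔤`).  It supplies the TRIPLE-LEVEL content of the (1.2) Lemma's factors: for a Lefschetz triple `(𝔤, h, 𝔞)`
(A1-84 `IsLefschetzTriple`) and a decomposition `𝔤 = 𝔤' × 𝔤''` into complementary ideals with `𝔤' ≠ 0`, the components
`(𝔤', h', 𝔞')` form a Lefschetz triple ("`𝔤^{(i)}` gets a grading from `ad_{h^{(i)}}` … `[h, f] = -2f` implies
`[h', f'] = -2f'`"), via the general fact that a SURJECTIVE homomorphic image `(φ 𝔤, φ h, φ 𝔞)` of a Lefschetz triple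
with `φ h ≠ 0` is a Lefschetz triple; consequently every finite-dimensional representation `M'` of `𝔤'` on which `h'`
acts non-trivially is a Lefschetz `𝔞'`-module with `𝔤(𝔞', M') = ` the image of `𝔤'` — "`𝔤'` resp. `𝔤''` corresponding
to `𝔤(𝔞, M')` resp. `𝔤(𝔞, M'')`".  Over a field of characteristic `0`, `𝔤` finite-dimensional.  DEFINITIONS WITH BODIES
(`idealComponent`, `lieIdealProj` — the projection `𝔤 → 𝔤'`, over any commutative ring; cf. the tree's
`Literature.Geometry.Kaehler.ComplexTorus.lieEquivProdOfIsCompl`, see the docstring of `lieIdealProj`) and PROVED theorems; no named fact, no `sorry`, no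
instance, no notation (D-0026 net debt `0`); `LieRing.ofAssociativeRing` on `𝔤𝔩(M')` enabled FILE-LOCALLY as in every
parent (needed for `LieModule.toEnd` in §3).

## Source, VERBATIM

E. Looijenga, V. A. Lunts, *A Lie algebra attached to a projective variety*, Invent. Math. **129** (1997) 361–412,
§1 (1.2) (held TeX text `paper:arxiv-alg-geom_9604014`, p0004 L94–L105; proof continued in the PDF text
`paper:arxiv-alg-geom-9604014`, p0007 L1):

> "Lemma. Let `M` be an irreducible Lefschetz `𝔞`-module and let `𝔤(𝔞, M) = 𝔤' × 𝔤''` be a decomposition of Lie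
> algebra's. Then this decomposition is graded and there exist irreducible Lefschetz `𝔞`-modules `M'` and `M''` such
> that `M ≅ M' ⊗ M''` as Lefschetz `𝔞`-modules with `𝔤'` resp. `𝔤''` corresponding to `𝔤(𝔞, M')` resp. `𝔤(𝔞, M'')`.
> Proof. Since the grading of `𝔤` is the eigen space decomposition of `ad_h` it is immediate that upon writing
> `h = (h', h'') ∈ 𝔤' × 𝔤''`, `𝔤^{(i)}` gets a grading from `ad_{h^{(i)}}` making the decomposition a graded one. …
> If the rational map `f : 𝔞 → 𝔤_{-2} = 𝔤'_{-2} ⊕ 𝔤''_{-2}` is written `(f', f'')`, then `[h, f] = -2f` implies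
> `[h', f'] = -2f'` and `[h'', f''] = -2f''`. So `M^{(i)}` [is] a Lefschetz module of `𝔞` with the stated property."

and §1 p0007 L54–L78 (Lefschetz triples; A1-84) with p0007 L67–L72 ("If `M` is a finite dimensional representation of
`𝔤`, then … `M` is then a Lefschetz module of `𝔞` … `𝔤(𝔞, M)` is just the image of `𝔤` in `𝔤𝔩(M)`"; A1-106).

## Rendering (dictionary)

* "`𝔤 = 𝔤' × 𝔤''` a decomposition of Lie algebra's" = complementary ideals `I = 𝔤'`, `J = 𝔤''` of `L = 𝔤`,
  `hIJ : IsCompl I J` (A1-112); "`h = (h', h'')`", "`f = (f', f'')`" = the component map `idealComponent hIJ : L →ₗ[K] L`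
  (`x ↦ x'`, `x - x' ∈ J`) and the projection `lieIdealProj hIJ : L →ₗ⁅K⁆ I` (a Lie algebra homomorphism onto `𝔤'`);
  `𝔞' = 𝔞.map (lieIdealProj hIJ)`, `h' = lieIdealProj hIJ h`.
* "So `M^{(i)}` a Lefschetz module of `𝔞` with the stated property": `(I, h', 𝔞')` is a Lefschetz triple
  (`IsLefschetzTriple.map_lieIdealProj`), hence (A1-106) every representation `M'` of `I` with `ρ h' ≠ 0` is a Lefschetz
  `ρ 𝔞'`-module with `𝔤(ρ 𝔞', M') = ρ(I)` (`IsLefschetzTriple.isLefschetzModule_toEnd_lieIdeal`).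

## Contents (all proved)

* §1 `image_lefschetzDuals_subset`, `image_lefschetzDomain_subset`, **`IsLefschetzTriple.map_of_surjective`** (a
  surjective image `(𝔤', φ h, φ 𝔞)` with `φ h ≠ 0` is a Lefschetz triple; semisimplicity by the tree's
  `isSemisimple_of_surjective`, generation by `map_lieSpan`).
* §2 (any `[CommRing R]`) `idealComponent` (+ `_mem`, `sub_…_mem`, `_apply_of_mem`, `_apply_of_mem'`,
  **`idealComponent_lie`**: `[x, y]' = [x', y']`), **`lieIdealProj`** (the Lie homomorphism `𝔤 → 𝔤'`) with
  `coe_lieIdealProj_apply`, `lieIdealProj_apply_of_mem`, `lieIdealProj_apply_of_mem'`, `sub_lieIdealProj_mem`,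
  `lieIdealProj_add_lieIdealProj` (`x = π_I x + π_J x`), `lieIdealProj_surjective`, `lie_eq_lieIdealProj_lie`.
* §3 `IsLefschetzTriple.lieIdealProj_h_ne_zero` (`h' ≠ 0` when `𝔤' ≠ 0`), **`IsLefschetzTriple.map_lieIdealProj`**
  (`(𝔤', h', 𝔞')` is a Lefschetz triple), `IsLefschetzTriple.map_lieIdealProj_symm` (the factor `𝔤''`),
  **`IsLefschetzTriple.isLefschetzModule_toEnd_lieIdeal`** (representations of `𝔤'` are Lefschetz `𝔞'`-modules with
  `𝔤(𝔞', M') = ρ(𝔤')`).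

## SCOPE

(a) The tensor clause `M ≅ M' ⊗ M''` is A1-135 `LefschetzTripleIdealsTensor.lean`; the combination of the two — the
particular `𝔤'`-module `M'` of that decomposition, the compatibility of the gradings and "as Lefschetz `𝔞`-modules" —
is not assembled here.  (b) `𝔤' ≠ 0` is assumed (for `𝔤' = 0` the factor is the zero triple, excluded by Mathlib's
`IsSl2Triple` convention `h ≠ 0`).  (c) Nothing here concerns complex tori or the Hodge conjecture.

## References

* [LooijengaLunts1997] E. Looijenga, V. A. Lunts, *A Lie algebra attached to a projective variety*, Invent. Math.
  129 (1997) 361–412; arXiv:alg-geom/9604014. §1 (1.2) Lemma and proof, p. 4 L94–L105 of the held TeX text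
  (continued: PDF text p. 7 L1); §1 p. 7 L54–L78.
* [Bourbaki1989LieGroups13] N. Bourbaki, *Lie Groups and Lie Algebras, Chapters 1–3* (1989), Ch. I §6 no. 2 Lemma 1
  (homomorphic images of semisimple Lie algebras) — via `ReductiveIdealsQuotients.lean`.
-/

noncomputable section

namespace Literature.Algebra.Lie

open Module Function Set LieModule LieAlgebra

-- The commutator Lie ring of `𝔤𝔩(M) = Module.End K M`: Mathlib's reducible NON-instance, enabled file-locally
-- exactly as in `LefschetzModule.lean` (needed for `LieModule.toEnd` into `𝔤𝔩(M')` in §3).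
attribute [local instance 100] LieRing.ofAssociativeRing

/-! ### §1 Surjective images of Lefschetz triples -/

section Surjective

variable {K : Type*} [Field K] [CharZero K] {L : Type*} [LieRing L] [LieAlgebra K L] [FiniteDimensional K L]
  {L' : Type*} [LieRing L'] [LieAlgebra K L'] [FiniteDimensional K L'] {h : L} {𝔞 : Submodule K L}

omit [CharZero K] [FiniteDimensional K L] [FiniteDimensional K L'] in
/-- A surjective Lie algebra homomorphism maps the image of `f` into the image of `f` of the image triple (when
`φ h ≠ 0`): `(e, h, f) ↦ (φ e, φ h, φ f)`. [cite: LooijengaLunts1997, §1 (1.2) Lemma, proof p0004 L101–L105 ("[h, f] = -2f implies [h', f'] = -2f'")] -/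
theorem image_lefschetzDuals_subset (φ : L →ₗ⁅K⁆ L') (h0 : φ h ≠ 0) :
    φ '' lefschetzDuals K h 𝔞 ⊆ lefschetzDuals K (φ h) (𝔞.map (φ : L →ₗ[K] L')) := by
  rintro _ ⟨f, ⟨e, he, t⟩, rfl⟩
  exact ⟨φ e, Submodule.mem_map_of_mem he, isSl2Triple_map_of_ne_zero φ t h0⟩

omit [CharZero K] [FiniteDimensional K L] [FiniteDimensional K L'] in
/-- Likewise for the domain of `f`. [cite: LooijengaLunts1997, §1 (1.2) Lemma, proof p0004 L101–L105] -/
theorem image_lefschetzDomain_subset (φ : L →ₗ⁅K⁆ L') (h0 : φ h ≠ 0) :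
    φ '' lefschetzDomain K h 𝔞 ⊆ lefschetzDomain K (φ h) (𝔞.map (φ : L →ₗ[K] L')) := by
  rintro _ ⟨e, ⟨he, f, t⟩, rfl⟩
  exact ⟨Submodule.mem_map_of_mem he, φ f, isSl2Triple_map_of_ne_zero φ t h0⟩

/-- **A surjective image of a Lefschetz triple is a Lefschetz triple**: if `(𝔤, h, 𝔞)` is a Lefschetz triple and
`φ : 𝔤 → 𝔤'` is a surjective homomorphism of Lie algebras with `φ(h) ≠ 0`, then `(𝔤', φ h, φ 𝔞)` is a Lefschetz
triple — `𝔤'` is semisimple (Bourbaki I §6), `φ 𝔞 ⊆ 𝔤'₂` is abelian, `(φ e, φ h, φ f_e)` are `𝔰𝔩₂`-triples, and `𝔤'`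
is generated by `φ 𝔞` and these `φ f_e`.  (For an isomorphism `φ`: A1-87 `IsLefschetzTriple.map`; the case of the
projection `𝔤' × 𝔤'' → 𝔤'` is Looijenga–Lunts' "upon writing `h = (h', h'')` … `[h, f] = -2f` implies
`[h', f'] = -2f'`".) [cite: LooijengaLunts1997, §1 (1.2) Lemma, proof p0004 L101–L105] [cite: LooijengaLunts1997, §1 p0007 L54–L78 (Lefschetz triple)] -/
theorem IsLefschetzTriple.map_of_surjective (T : IsLefschetzTriple K h 𝔞) (φ : L →ₗ⁅K⁆ L')
    (hφ : Function.Surjective φ) (h0 : φ h ≠ 0) : IsLefschetzTriple K (φ h) (𝔞.map (φ : L →ₗ[K] L')) where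
  isSemisimple := by
    haveI := T.isSemisimple
    exact isSemisimple_of_surjective φ hφ
  le_adDegree_two := by
    rintro _ ⟨a, ha, rfl⟩
    rw [mem_adDegree_iff]
    show ⁅φ h, φ a⁆ = (2 : K) • φ a
    rw [← LieHom.map_lie, mem_adDegree_iff.1 (T.le_adDegree_two ha), map_smul]
  lie_eq_zero := by
    rintro _ ⟨a, ha, rfl⟩ _ ⟨b, hb, rfl⟩
    show ⁅φ a, φ b⁆ = 0
    rw [← LieHom.map_lie, T.lie_eq_zero a ha b hb, map_zero]
  nonempty_lefschetzDomain := by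
    obtain ⟨e, he⟩ := T.nonempty_lefschetzDomain
    exact ⟨φ e, image_lefschetzDomain_subset φ h0 ⟨e, he, rfl⟩⟩
  lieSpan_eq_top := by
    refine top_le_iff.1 ?_
    have h1 : (⊤ : LieSubalgebra K L') ≤ (⊤ : LieSubalgebra K L).map φ := by
      intro x _
      obtain ⟨y, rfl⟩ := hφ x
      exact (LieSubalgebra.mem_map _ _ _).2 ⟨y, LieSubalgebra.mem_top y, rfl⟩
    refine h1.trans ?_
    rw [← T.lieSpan_eq_top, map_lieSpan]
    refine LieSubalgebra.lieSpan_mono ?_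
    rw [Set.image_union]
    refine Set.union_subset_union ?_ (image_lefschetzDuals_subset φ h0)
    rintro _ ⟨a, ha, rfl⟩
    exact Submodule.mem_map_of_mem ha

end Surjective

/-! ### §2 The projection `𝔤 = 𝔤' ⊕ 𝔤'' → 𝔤'` onto an ideal factor -/

section IdealProj

variable {R : Type*} [CommRing R] {L : Type*} [LieRing L] [LieAlgebra R L] {I J : LieIdeal R L}

/-- The `𝔤'`-component `x ↦ x'` of `x = x' + x''` along `𝔤 = 𝔤' ⊕ 𝔤''`, as a linear map `𝔤 → 𝔤`.
[cite: LooijengaLunts1997, §1 (1.2) Lemma, proof p0004 L101–L103 ("upon writing h = (h', h'') ∈ 𝔤' × 𝔤''")] -/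
def idealComponent (hIJ : IsCompl I J) : L →ₗ[R] L :=
  I.toSubmodule.projection J.toSubmodule (LieSubmodule.isCompl_toSubmodule.2 hIJ)

/-- `x' ∈ 𝔤'`. [cite: LooijengaLunts1997, §1 (1.2) p0004 L101–L103] -/
theorem idealComponent_mem (hIJ : IsCompl I J) (x : L) : idealComponent hIJ x ∈ I :=
  Submodule.projection_apply_mem (LieSubmodule.isCompl_toSubmodule.2 hIJ) x

/-- `x - x' ∈ 𝔤''`. [cite: LooijengaLunts1997, §1 (1.2) p0004 L101–L103] -/
theorem sub_idealComponent_mem (hIJ : IsCompl I J) (x : L) : x - idealComponent hIJ x ∈ J :=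
  Submodule.sub_projection_mem (LieSubmodule.isCompl_toSubmodule.2 hIJ) x

/-- `x' = x` for `x ∈ 𝔤'`. [cite: LooijengaLunts1997, §1 (1.2) p0004 L101–L103] -/
theorem idealComponent_apply_of_mem (hIJ : IsCompl I J) {x : L} (hx : x ∈ I) : idealComponent hIJ x = x :=
  Submodule.projection_apply_of_mem_left (LieSubmodule.isCompl_toSubmodule.2 hIJ) hx

/-- `x' = 0` for `x ∈ 𝔤''`. [cite: LooijengaLunts1997, §1 (1.2) p0004 L101–L103] -/
theorem idealComponent_apply_of_mem' (hIJ : IsCompl I J) {x : L} (hx : x ∈ J) : idealComponent hIJ x = 0 :=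
  (Submodule.projection_apply_eq_zero_iff (LieSubmodule.isCompl_toSubmodule.2 hIJ)).2 hx

/-- **The component map respects brackets**: `[x, y]' = [x', y']` (the cross terms `[x', y - y']`, `[x - x', y]`
lie in the ideal `𝔤''`). [cite: LooijengaLunts1997, §1 (1.2) p0004 L101–L105] -/
theorem idealComponent_lie (hIJ : IsCompl I J) (x y : L) :
    idealComponent hIJ ⁅x, y⁆ = ⁅idealComponent hIJ x, idealComponent hIJ y⁆ := by
  have h1 : ⁅x, y⁆ = ⁅idealComponent hIJ x, idealComponent hIJ y⁆ +
      (⁅x - idealComponent hIJ x, y⁆ + ⁅idealComponent hIJ x, y - idealComponent hIJ y⁆) := by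
    rw [sub_lie, lie_sub]; abel
  have h2 : ⁅x - idealComponent hIJ x, y⁆ + ⁅idealComponent hIJ x, y - idealComponent hIJ y⁆ ∈ J :=
    J.add_mem (lie_mem_left R L J _ _ (sub_idealComponent_mem hIJ x))
      (lie_mem_right R L J _ _ (sub_idealComponent_mem hIJ y))
  rw [h1, map_add, idealComponent_apply_of_mem hIJ (lie_mem_left R L I _ _ (idealComponent_mem hIJ x)),
    idealComponent_apply_of_mem' hIJ h2, add_zero]

/-- **The projection `𝔤 = 𝔤' ⊕ 𝔤'' → 𝔤'`, `x = (x', x'') ↦ x'`, a homomorphism of Lie algebras** onto the ideal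
factor `I = 𝔤'` (any commutative coefficient ring).  Relation to the tree: with
`Literature.Geometry.Kaehler.ComplexTorus.lieEquivProdOfIsCompl I J hIJ : (I × J) ≃ₗ⁅R⁆ L`
(`ComplexTorusNeronSeveriLieAlgebraRatGrading.lean`, which `Algebra/Lie` must not import) one has
`lieIdealProj hIJ = (LieHom.fst R I J).comp (lieEquivProdOfIsCompl I J hIJ).symm`; a librarian refactor moving that
`LieProduct` block here and deriving it from `lieIdealProj` is requested in the proposal note.
[cite: LooijengaLunts1997, §1 (1.2) Lemma, proof p0004 L101–L103 ("upon writing h = (h', h'') ∈ 𝔤' × 𝔤''")] -/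
def lieIdealProj (hIJ : IsCompl I J) : L →ₗ⁅R⁆ I :=
  { toFun := fun x ↦ ⟨idealComponent hIJ x, idealComponent_mem hIJ x⟩
    map_add' := fun x y ↦ Subtype.ext (by simp only [map_add]; rfl)
    map_smul' := fun c x ↦ Subtype.ext (by simp only [map_smul]; rfl)
    map_lie' := fun {x y} ↦ Subtype.ext (idealComponent_lie hIJ x y) }

/-- The projection in coordinates: `↑(π x) = x'`. [cite: LooijengaLunts1997, §1 (1.2) p0004 L101–L103] -/
theorem coe_lieIdealProj_apply (hIJ : IsCompl I J) (x : L) : (lieIdealProj hIJ x : L) = idealComponent hIJ x := rfl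

/-- `π x = x` on `𝔤' = I`. [cite: LooijengaLunts1997, §1 (1.2) p0004 L101–L103] -/
theorem lieIdealProj_apply_of_mem (hIJ : IsCompl I J) {x : L} (hx : x ∈ I) : (lieIdealProj hIJ x : L) = x := by
  rw [coe_lieIdealProj_apply, idealComponent_apply_of_mem hIJ hx]

/-- `π x = 0` on `𝔤'' = J`. [cite: LooijengaLunts1997, §1 (1.2) p0004 L101–L103] -/
theorem lieIdealProj_apply_of_mem' (hIJ : IsCompl I J) {x : L} (hx : x ∈ J) : lieIdealProj hIJ x = 0 :=
  Subtype.ext (by rw [coe_lieIdealProj_apply, idealComponent_apply_of_mem' hIJ hx]; rfl)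

/-- `x - π x ∈ 𝔤'' = J` (the other component). [cite: LooijengaLunts1997, §1 (1.2) p0004 L101–L103] -/
theorem sub_lieIdealProj_mem (hIJ : IsCompl I J) (x : L) : x - (lieIdealProj hIJ x : L) ∈ J :=
  sub_idealComponent_mem hIJ x

/-- **`h = (h', h'')`**: `x = π_I x + π_J x`. [cite: LooijengaLunts1997, §1 (1.2) p0004 L101–L103 ("upon writing h = (h', h'') ∈ 𝔤' × 𝔤''")] -/
theorem lieIdealProj_add_lieIdealProj (hIJ : IsCompl I J) (x : L) :
    (lieIdealProj hIJ x : L) + (lieIdealProj hIJ.symm x : L) = x := by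
  have h1 : (lieIdealProj hIJ.symm x : L) = x - (lieIdealProj hIJ x : L) := by
    have h2 := lieIdealProj_apply_of_mem hIJ.symm (sub_lieIdealProj_mem hIJ x)
    have h3 : lieIdealProj hIJ.symm (lieIdealProj hIJ x : L) = 0 :=
      lieIdealProj_apply_of_mem' hIJ.symm (lieIdealProj hIJ x).2
    rw [map_sub, h3, sub_zero] at h2
    exact h2
  rw [h1]; abel

/-- The projection is onto `𝔤'`. [cite: LooijengaLunts1997, §1 (1.2) p0004 L101–L103] -/
theorem lieIdealProj_surjective (hIJ : IsCompl I J) : Function.Surjective (lieIdealProj hIJ) :=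
  fun x ↦ ⟨x, Subtype.ext (lieIdealProj_apply_of_mem hIJ x.2)⟩

/-- On `𝔤'` the brackets with `x` and with `π x` agree: `[x, y] = [π x, y]` for `y ∈ I` (so `ad h = ad h'` on `𝔤'`,
A1-112 `lie_eq_lie_of_isCompl_lieIdeal`). [cite: LooijengaLunts1997, §1 (1.2) p0004 L101–L105] -/
theorem lie_eq_lieIdealProj_lie (hIJ : IsCompl I J) (x : L) {y : L} (hy : y ∈ I) :
    ⁅x, y⁆ = ⁅(lieIdealProj hIJ x : L), y⁆ := by
  have h1 : ⁅x - (lieIdealProj hIJ x : L), y⁆ ∈ I ⊓ J :=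
    (LieSubmodule.mem_inf _ _ _).2 ⟨lie_mem_right R L I _ _ hy, lie_mem_left R L J _ _ (sub_lieIdealProj_mem hIJ x)⟩
  rw [hIJ.inf_eq_bot, LieSubmodule.mem_bot, sub_lie, sub_eq_zero] at h1
  exact h1

end IdealProj

/-! ### §3 The ideal factors of a Lefschetz triple are Lefschetz triples -/

section Factor

variable {K : Type*} [Field K] [CharZero K] {L : Type*} [LieRing L] [LieAlgebra K L] [FiniteDimensional K L]
  {h : L} {𝔞 : Submodule K L} {I J : LieIdeal K L}

omit [FiniteDimensional K L] in
/-- For a Lefschetz triple `(𝔤, h, 𝔞)` with `𝔤 = 𝔤' × 𝔤''` and `𝔤' ≠ 0`, the component `h'` of `h` is non-zero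
(otherwise `𝔞` and every `f_e` would have zero `𝔤'`-component, and they generate `𝔤`).
[cite: LooijengaLunts1997, §1 (1.2) Lemma, proof p0004 L101–L105] -/
theorem IsLefschetzTriple.lieIdealProj_h_ne_zero (T : IsLefschetzTriple K h 𝔞) (hIJ : IsCompl I J) (hI : I ≠ ⊥) :
    lieIdealProj hIJ h ≠ 0 := by
  intro h0
  set π := lieIdealProj hIJ with hπ
  -- `π` kills `𝔞` and the image of `f`
  have h𝔞 : ∀ a ∈ 𝔞, π a = 0 := by
    intro a ha
    have h1 : ⁅π h, π a⁆ = (2 : K) • π a := by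
      rw [← LieHom.map_lie, mem_adDegree_iff.1 (T.le_adDegree_two ha), map_smul]
    rw [h0, zero_lie] at h1
    exact (smul_eq_zero.1 h1.symm).resolve_left two_ne_zero
  have hf : ∀ f ∈ lefschetzDuals K h 𝔞, π f = 0 := by
    rintro f ⟨e, -, t⟩
    have h1 : π ⁅h, f⁆ = -((2 : K) • π f) := by
      rw [t.lie_h_f_nsmul, map_neg, ← Nat.cast_smul_eq_nsmul K, map_smul, Nat.cast_ofNat]
    rw [LieHom.map_lie, h0, zero_lie] at h1
    exact (smul_eq_zero.1 (neg_eq_zero.1 h1.symm)).resolve_left two_ne_zero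
  -- hence `π = 0`, contradicting surjectivity onto `I ≠ 0`
  have h2 : (⊤ : LieSubalgebra K L).map π ≤ ⊥ := by
    rw [← T.lieSpan_eq_top, map_lieSpan, LieSubalgebra.lieSpan_le]
    rintro _ ⟨x, hx | hx, rfl⟩
    · exact (h𝔞 x hx).symm ▸ (⊥ : LieSubalgebra K I).zero_mem
    · exact (hf x hx).symm ▸ (⊥ : LieSubalgebra K I).zero_mem
  apply hI
  rw [eq_bot_iff]
  intro x hx
  have h3 : (⟨x, hx⟩ : I) ∈ (⊤ : LieSubalgebra K L).map π := by
    obtain ⟨y, hy⟩ := lieIdealProj_surjective hIJ ⟨x, hx⟩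
    exact (LieSubalgebra.mem_map _ _ _).2 ⟨y, LieSubalgebra.mem_top y, hy⟩
  have h4 := h2 h3
  rw [LieSubalgebra.mem_bot] at h4
  rw [LieSubmodule.mem_bot]
  exact congrArg Subtype.val h4

/-- **Looijenga–Lunts (1.2) Lemma, the factors at the level of triples: for a Lefschetz triple `(𝔤, h, 𝔞)` and a
decomposition `𝔤 = 𝔤' × 𝔤''` into ideals with `𝔤' ≠ 0`, `(𝔤', h', 𝔞')` is a Lefschetz triple** — `h'` and `𝔞'` the
`𝔤'`-components of `h` and `𝔞` ("`𝔤^{(i)}` gets a grading from `ad_{h^{(i)}}` … if `f` is written `(f', f'')`, then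
`[h, f] = -2f` implies `[h', f'] = -2f'`"), so that every representation of `𝔤'` is a Lefschetz `𝔞'`-module with
`𝔤(𝔞', ·)` the image of `𝔤'` (A1-106 `IsLefschetzTriple.isLefschetzModule_toEnd`).
[cite: LooijengaLunts1997, §1 (1.2) Lemma and proof, p0004 L94–L105] -/
theorem IsLefschetzTriple.map_lieIdealProj (T : IsLefschetzTriple K h 𝔞) (hIJ : IsCompl I J) (hI : I ≠ ⊥) :
    IsLefschetzTriple K (lieIdealProj hIJ h) (𝔞.map (lieIdealProj hIJ : L →ₗ[K] I)) :=
  haveI : FiniteDimensional K I := inferInstanceAs (FiniteDimensional K (I : Submodule K L))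
  T.map_of_surjective (lieIdealProj hIJ) (lieIdealProj_surjective hIJ) (T.lieIdealProj_h_ne_zero hIJ hI)

/-- The same for the second factor `𝔤''` (symmetry of `IsCompl`). [cite: LooijengaLunts1997, §1 (1.2) Lemma p0004 L94–L105] -/
theorem IsLefschetzTriple.map_lieIdealProj_symm (T : IsLefschetzTriple K h 𝔞) (hIJ : IsCompl I J) (hJ : J ≠ ⊥) :
    IsLefschetzTriple K (lieIdealProj hIJ.symm h) (𝔞.map (lieIdealProj hIJ.symm : L →ₗ[K] J)) :=
  T.map_lieIdealProj hIJ.symm hJ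

/-- **Every representation of the factor `𝔤'` is a Lefschetz `𝔞'`-module with `𝔤(𝔞', M') = ` the image of `𝔤'`**
("there exist … Lefschetz `𝔞`-modules `M'` … with `𝔤'` … corresponding to `𝔤(𝔞, M')`"): for a finite-dimensional
Lie module `M'` of `I = 𝔤'` on which `h'` acts non-trivially, `(ρ 𝔞', M')` is a Lefschetz module (A1-88) and
`𝔤(ρ 𝔞', M') = ρ(𝔤')` — A1-106 applied to the factor triple. [cite: LooijengaLunts1997, §1 (1.2) Lemma p0004 L94–L105] -/
theorem IsLefschetzTriple.isLefschetzModule_toEnd_lieIdeal (T : IsLefschetzTriple K h 𝔞) (hIJ : IsCompl I J)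
    (hI : I ≠ ⊥) {M' : Type*} [AddCommGroup M'] [Module K M'] [FiniteDimensional K M'] [LieRingModule I M']
    [LieModule K I M'] (h0 : toEnd K I M' (lieIdealProj hIJ h) ≠ 0) :
    IsLefschetzModule K (toEnd K I M' (lieIdealProj hIJ h))
        ((𝔞.map (lieIdealProj hIJ : L →ₗ[K] I)).map (toEnd K I M' : I →ₗ[K] Module.End K M')) ∧
      lefschetzLieAlgebra K (toEnd K I M' (lieIdealProj hIJ h))
        ((𝔞.map (lieIdealProj hIJ : L →ₗ[K] I)).map (toEnd K I M' : I →ₗ[K] Module.End K M')) =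
        (toEnd K I M').range :=
  haveI : FiniteDimensional K I := inferInstanceAs (FiniteDimensional K (I : Submodule K L))
  ⟨(T.map_lieIdealProj hIJ hI).isLefschetzModule_toEnd h0, (T.map_lieIdealProj hIJ hI).lefschetzLieAlgebra_map_toEnd h0⟩

end Factor

end Literature.Algebra.Lie
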